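import Mathlib
import Literature.AlgebraicGeometry.Resolution.BoundedPreparation
import Literature.AlgebraicGeometry.Resolution.ReAdaptation
import HarnessLib

/-!
# Bounded preparedness contains `v`- and `w⁻`-preparedness, and makes very near points adapted (CJS Lemma 12.1 (2) / 13.2 (1))

Topic: `Literature/AlgebraicGeometry/Resolution`. Cossart–Jannsen–Saito, LNM 2270, Lemma 12.1 (2) /
Lemma 13.2 (1) (printed pp. 162, 168: "If `x′` is very near to `x`, then `(f′, y′, (u₁, u′₂))` is a
prelabel of `(X′, Z′)` at `x′`" — a LABEL, i.e. adapted: `in_𝔪′(f′) = F(Y′)`, `δ′ > 1` — for a prepared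
`(f, y, u)`), and Cossart–Piltant 2008, proof of Lemma 4.5 (2), p. 12 ("we possibly have to change
`z′` with `w := z′ − θ`" — NOT needed once the relevant vertex is prepared). In the words of the tree's
`ReAdaptation.lean`: at a near point with `τ = 1` the shape of `cl_μ(J′)` is `(Y′ + b U₁)^μ`; `b ≠ 0`
means the vertex `(1, 0)` is solvable along the tilted line `x₁ + 2x₂ = 1`, which bounded
preparedness forbids; so `b = 0` and the system is adapted (`δ > L`).

PROVED here (no facts, no definitions), for `PreparedUpTo` of `BoundedPreparation.lean`:

* `vPrepared_of_preparedUpTo` — `PreparedUpTo c J μ B` with `αs ≤ B` (`J ⊆ 𝔪^μ`) gives `VPrepared`.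
* `wMinusPrepared_of_preparedUpTo` — with `δs − γ⁻s ≤ B` it gives `WMinusPrepared`.
* `lt_deltaS_of_preparedUpTo_of_hironakaTauAt_eq_one` — **prepared ⇒ adapted at a very near point**:
  `J ⊆ 𝔪^μ` with Newton points, `τ(cl_μ J) = 1`, a monic element (`HasMonic`), `VPrepared` and
  `PreparedUpTo c J μ B` with `L ≤ B` ⇒ `L < δs` (so `cl_μ J ⊆ k·Y^μ`: the coordinates are adapted, no
  re-adaptation `y ↦ y + b̃ u₁` is needed). Combined with `preparedUpTo_colon` (the transported system at
  a very near `u₁`-origin is `PreparedUpTo (B − L)`) this keeps the coordinates FIXED along a chain of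
  very near points — the situation of `AxialUnitChainLaw`.

AI-written; weaker than expert review.

## Sources

* V. Cossart, U. Jannsen, S. Saito, LNM 2270 (2020), Lemma 12.1 (2), Lemma 13.2 (1), Lemma 11.4.
  [CossartJannsenSaito2020]
* V. Cossart, O. Piltant, J. Algebra 320 (2008), proof of Lemma 4.5 (2), p. 12. [CossartPiltant2008]
-/

noncomputable section

open IsLocalRing MvPolynomial

namespace Literature.AlgebraicGeometry.Resolution

universe u

section Prepared

variable {R : Type u} [CommRing R] [IsRegularLocalRing R] (c : Fin 3 → R)
  (hgen : Ideal.span {c 0, c 1, c 2} = maximalIdeal R) (hdim : ringKrullDim R = 3)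
  {J : Ideal R} {μ : ℕ}

include hgen hdim in
/-- **Bounded preparedness includes `v`-preparedness** (the vertex `v = (α, β)` is realised, alone on
the canonical steep line, and has abscissa `αs ≤ B`). [cite: CossartJannsenSaito2020, Def. 11.2] -/
theorem vPrepared_of_preparedUpTo (hJμ : J ≤ maximalIdeal R ^ μ) (hne : (pts c J μ).Nonempty) {B : ℕ}
    (hB : alphaS c J μ ≤ B) (h : PreparedUpTo c J μ B) : VPrepared c J μ := by
  intro v₁ v₂ lam hv₁ hv₂
  obtain ⟨e, he, he1, he2⟩ := exists_pts_v hne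
  have hαβ : μ.factorial ≤ alphaS c J μ + betaS c J μ := by
    have := factorial_le_spt_add c hgen hdim hJμ he; omega
  have hpos : 0 < vLevel c J μ := by
    rw [vLevel, steepN]
    have : alphaS c J μ ≤ (betaS c J μ + 1) * alphaS c J μ := Nat.le_mul_of_pos_left _ (by omega)
    have := Nat.factorial_pos μ
    omega
  refine h (vLevel c J μ) (steepN c J μ) 1 hpos (by rw [steepN]; omega) Nat.one_pos
    forall_pts_vWeight v₁ v₂ (by rw [← hv₁]; exact hB) ?_ ⟨e, he, by rw [he1, hv₁], by rw [he2, hv₂]⟩ ?_ lam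
  · rw [vLevel, hv₁, hv₂]; ring
  · intro x hx hline
    obtain ⟨h1, h2⟩ := eq_v_of_vLine hx hline
    exact ⟨by rw [h1, hv₁], by rw [h2, hv₂]⟩

include hgen hdim in
/-- **Bounded preparedness includes `w⁻`-preparedness** (the vertex `w⁻ = (δ − γ⁻, γ⁻)` is realised,
alone on the canonical tilted line, and has abscissa `δs − γ⁻s ≤ B`).
[cite: CossartJannsenSaito2020, Lemma 12.1 (4)] -/
theorem wMinusPrepared_of_preparedUpTo (hJμ : J ≤ maximalIdeal R ^ μ) (hne : (pts c J μ).Nonempty)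
    {B : ℕ} (hB : deltaS c J μ - gammaMinusS c J μ ≤ B) (h : PreparedUpTo c J μ B) :
    WMinusPrepared c J μ := by
  intro v₁ v₂ lam hv₁ hv₂
  obtain ⟨e, he, hsum, he2⟩ := exists_pts_wMinus hne
  have hδ : μ.factorial ≤ deltaS c J μ := by
    have := factorial_le_spt_add c hgen hdim hJμ he; omega
  have hpos : 0 < wMinusLevel c J μ := by
    rw [wMinusLevel, tiltN]
    have : deltaS c J μ ≤ (gammaMinusS c J μ + 1) * deltaS c J μ := Nat.le_mul_of_pos_left _ (by omega)
    have := Nat.factorial_pos μ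
    omega
  have he1 : spt₁ μ e = μ.factorial * v₁ := by omega
  refine h (wMinusLevel c J μ) (tiltN c J μ) (tiltN c J μ + 1) hpos (by rw [tiltN]; omega) (by omega)
    forall_pts_wMinusWeight v₁ v₂ (by rw [← he1]; omega) ?_ ⟨e, he, he1, by rw [he2, hv₂]⟩ ?_ lam
  · rw [wMinusLevel, hv₁, hv₂]; ring
  · intro x hx hline
    obtain ⟨h1, h2⟩ := eq_wMinus_of_wMinusLine hx hline
    exact ⟨by omega, by rw [h2, hv₂]⟩

include hgen hdim in
/-- **PREPARED ⇒ ADAPTED AT A VERY NEAR POINT** (CJS Lemma 12.1 (2) / 13.2 (1): the transported prelabel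
of a prepared label is a label; CP p. 12). If `J ⊆ 𝔪^μ` has Newton points, `τ(cl_μ J) = 1` with respect to
`c = (y, u₁, u₂)`, some `in_μ(g)` has a `Y^μ` term, `c` is `𝐯`-prepared and prepared at every vertex of
scaled abscissa `≤ B` with `L ≤ B`, then `δ > L`: all initial forms are multiples of `Y^μ`, i.e. `c`
is adapted to the directrix — no re-adaptation is needed. (The shape is `(Y + bU₁)^μ`; `b ≠ 0` would
make the realised vertex `(L, 0)` solvable along the tilted line `x₁ + 2x₂ = L`, alone on it.)
[cite: CossartJannsenSaito2020, Lemma 13.2 (1)] [cite: CossartPiltant2008, Lemma 4.5 (2)] -/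
theorem lt_deltaS_of_preparedUpTo_of_hironakaTauAt_eq_one (hJμ : J ≤ maximalIdeal R ^ μ)
    (hne : (pts c J μ).Nonempty) (hτ : hironakaTauAt c J μ = 1) (hmon : HasMonic c J μ)
    (hvprep : VPrepared c J μ) {B : ℕ} (hB : μ.factorial ≤ B) (h : PreparedUpTo c J μ B) :
    μ.factorial < deltaS c J μ := by
  classical
  have hμ : 0 < μ := by obtain ⟨e, he⟩ := hne; have := he.2; omega
  obtain ⟨b, cc, hshape⟩ := exists_linShape_of_hironakaTauAt_eq_one c hgen hdim hJμ hμ hτ hmon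
  have hcc : cc = 0 := LinShape.cc_eq_zero c hgen hdim hJμ hne hvprep hshape hmon
  subst hcc
  by_cases hb : b = 0
  · subst hb
    refine lt_deltaS_of_forall_initialForms c hgen hdim hJμ hne fun G hG => ?_
    obtain ⟨g, hgJ, rfl⟩ := (mem_initialForms_iff_exists_inForm c hgen hdim hJμ G).mp hG
    obtain ⟨a, ha⟩ := hshape g hgJ
    exact ⟨a, by rw [ha, C_0, zero_mul, zero_mul, add_zero, add_zero]⟩
  · exfalso
    -- the vertex `(L, 0)` is realised: `in_μ(g₀) = a (Y + b U₁)^μ` with `a ≠ 0` has a `U₁^μ` term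
    obtain ⟨g₀, hg₀J, hg₀⟩ := hmon
    obtain ⟨a₀, ha₀⟩ := hshape g₀ hg₀J
    have ha₀ne : a₀ ≠ 0 := by
      intro h0
      apply hg₀
      rw [LinShape.coeff_single_zero c ha₀, h0]
    have hcoeff : (inForm c (fun _ => 1) μ g₀).coeff (Finsupp.single 1 μ) ≠ 0 := by
      rw [ha₀, coeff_C_mul, coeff_linearPow_single_one]
      exact mul_ne_zero ha₀ne (pow_ne_zero _ hb)
    have hreal := mem_pts_of_coeff_inForm_one_ne_zero c hgen hdim hJμ hg₀J
      (m := Finsupp.single 1 μ) (by simp [hμ]) hcoeff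
    obtain ⟨hs1, hs2⟩ := spt_single_one (μ := μ) hμ
    obtain ⟨hTsupp, hTuniq, -, -⟩ := forall_pts_tiltL c hgen hdim hJμ
    have hsolv := isSolvableAt_tilt_two_of_forall_inForm c hgen hdim hJμ hshape
    refine h μ.factorial 1 2 (Nat.factorial_pos μ) Nat.one_pos (by norm_num) hTsupp 1 0 (by omega)
      (by ring) ⟨Finsupp.single 1 μ, hreal, by rw [hs1, mul_one], by rw [hs2, mul_zero]⟩ hTuniq b hsolv

end Prepared

end Literature.AlgebraicGeometry.Resolution

end
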